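import Mathlib.Analysis.Complex.Basic
import Mathlib.MeasureTheory.Measure.Lebesgue.Basic
import Mathlib.Data.Nat.Factorial.Basic
import HarnessLib

/-!
# Cartan's lemma on the size of a polynomial outside small discs (H. Cartan 1928)

Topic `Literature/Analysis/Complex`, sub-namespace `Cartan`. Everything in this file is PROVED.

**Cartan's lemma** (the Boutroux–Cartan lemma; H. Cartan, Ann. Sci. ENS 45 (1928); B. Ja. Levin,
*Distribution of zeros of entire functions*, Ch. I §7, Thm. 10): given points `z₁, …, zₙ ∈ ℂ` (with
repetitions allowed) and `H > 0`, there is a finite system of discs, the sum of whose radii is at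
most `2H`, such that for every `w` outside these discs

  `∏_{j=1}^{n} |w − z_j| ≥ n! (H/n)ⁿ  (> (H/e)ⁿ)`.

We prove it in this form (`Cartan.exists_discs_prod_ge`, the discs given as a list of
`(centre, radius)`), by Cartan's covering argument, and deduce the form used in Turán's power-sum
method (`Cartan.exists_radius_prod_ge`): in every interval of radii of length `> 4H` there is a
radius `r` such that `∏ |w − z_j| ≥ n!(H/n)ⁿ` on the whole circle `|w| = r`.

## The argument

Put `δ = H/n`. *Construction.* Let `λ₁` be the largest integer `λ ∈ [1, n]` such that some closed
disc of radius `λδ` contains at least `λ` of the points, `C₁` such a disc, and remove the points in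
`C₁`; repeat with the remaining points (largest `λ₂` such that a disc of radius `λ₂δ` contains `≥ λ₂`
remaining points, …) until no point is left. At stage `k` at least `λ_k ≥ 1` points are removed, so
`∑ λ_k ≤ n` and the discs `C̃_k` (same centres, radii `2λ_kδ`) have radii summing to `≤ 2H`.
*Counting.* Let `w` lie outside every `C̃_k` and `j ≥ 1`. If the open disc `B(w, jδ)` contained
`≥ j` points, look at the first stage `k` at which one of them, `x`, is removed: all of them are
still present, so `j ≤ λ_k` by maximality, and `dist(w, c_k) ≤ dist(w, x) + dist(x, c_k) <
jδ + λ_kδ ≤ 2λ_kδ`, a contradiction. Hence `B(w, jδ)` contains at most `j − 1` points for every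
`j ≥ 1` (`exists_discs`), and therefore (removing a farthest point and inducting)
`∏ |w − z_j| ≥ ∏_{j=1}^{n} (jδ) = n! δⁿ` (`factorial_mul_pow_le_prod`).
*Circles.* A point `w` with `|w| = r` lies in a disc `D(c, ρ)` only if `r ∈ (|c| − ρ, |c| + ρ)`;
these intervals have total length `≤ 4H`, so an interval of radii of length `> 4H` contains a good
`r` (Lebesgue measure).

## References

* H. Cartan, *Sur les systèmes de fonctions holomorphes à variétés linéaires lacunaires et leurs
  applications*, Ann. Sci. ENS (3) 45 (1928) 255–346 [Cartan1928].
* P. Turán, *On Carlson's theorem in the theory of the zeta-function of Riemann*, Acta Math.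
  Acad. Sci. Hungar. 2 (1951), p. 48–49 (use of Cartan's lemma in the second main theorem)
  [Turan1951Carlson]; reproduced in Cheng–Hassani–Fox, arXiv:1010.3371v2, §6 Lemma 7
  [ChengHassaniFox2010].
-/

noncomputable section

open Finset Metric

namespace Literature.Analysis.Complex.Cartan

open _root_.Complex _root_.MeasureTheory

variable {ι : Type*}

/-! ### Counting: from "no crowded discs around `w`" to the product bound -/

/-- If for every `j ≥ 1` fewer than `j` of the numbers `d_i` (`i ∈ s`) are `< jδ`, then
`∏_{i ∈ s} d_i ≥ (#s)! δ^{#s}`. [cite: Cartan1928, Levin Ch. I §7 Thm 10] -/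
theorem factorial_mul_pow_le_prod [DecidableEq ι] (s : Finset ι) (d : ι → ℝ) {δ : ℝ} (hδ : 0 < δ)
    (h : ∀ j : ℕ, 1 ≤ j → (s.filter fun i => d i < j * δ).card ≤ j - 1) :
    ((s.card.factorial : ℕ) : ℝ) * δ ^ s.card ≤ ∏ i ∈ s, d i := by
  -- induct on `s`, inserting a point of maximal `d` each time; carry `t ⊆ s`
  suffices H : ∀ t : Finset ι, t ⊆ s → ((t.card.factorial : ℕ) : ℝ) * δ ^ t.card ≤ ∏ i ∈ t, d i from
    H s subset_rfl
  intro t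
  induction t using Finset.induction_on_max_value d with
  | empty => intro _; simp
  | insert a t hat hmax ih =>
    intro hts
    have hts' : t ⊆ s := (subset_insert a t).trans hts
    have has : a ∈ s := hts (mem_insert_self a t)
    -- `d a ≥ (#t + 1) δ`: otherwise the `#t + 1` points of `insert a t` are all `< (#t+1)δ`
    have hda : ((t.card + 1 : ℕ) : ℝ) * δ ≤ d a := by
      by_contra hlt
      push Not at hlt
      have hsub : insert a t ⊆ s.filter fun i => d i < ((t.card + 1 : ℕ) : ℝ) * δ := by
        intro x hx
        rw [mem_filter]
        refine ⟨hts hx, ?_⟩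
        rcases mem_insert.1 hx with rfl | hxt
        · exact hlt
        · exact (hmax x hxt).trans_lt hlt
      have h1 := card_le_card hsub
      have h2 := h (t.card + 1) (by omega)
      rw [card_insert_of_notMem hat] at h1
      omega
    rw [prod_insert hat, card_insert_of_notMem hat, Nat.factorial_succ, Nat.cast_mul, pow_succ]
    have hih := ih hts'
    have hfac : (0 : ℝ) ≤ ((t.card.factorial : ℕ) : ℝ) * δ ^ t.card := by positivity
    calc ((t.card + 1 : ℕ) : ℝ) * ((t.card.factorial : ℕ) : ℝ) * (δ ^ t.card * δ)
        = (((t.card + 1 : ℕ) : ℝ) * δ) * (((t.card.factorial : ℕ) : ℝ) * δ ^ t.card) := by ring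
      _ ≤ d a * ∏ i ∈ t, d i :=
          mul_le_mul hda hih hfac ((by positivity : (0:ℝ) ≤ ((t.card + 1 : ℕ) : ℝ) * δ).trans hda)

/-! ### Cartan's covering construction -/

/-- **Cartan's construction.** For a finite set `A` of indices, points `z_i` and `δ > 0` there is a
list of pairs `(c_k, λ_k)` (centres and integer multiplicities, `λ_k ≥ 1`, `∑ λ_k ≤ #A`) such that
every `w` with `dist(w, c_k) ≥ 2λ_kδ` for all `k` has, for every `j ≥ 1`, at most `j − 1` of the
points `z_i`, `i ∈ A`, in the open disc `B(w, jδ)`. [cite: Cartan1928, Levin Ch. I §7 Thm 10] -/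
theorem exists_discs [DecidableEq ι] (z : ι → ℂ) {δ : ℝ} (hδ : 0 < δ) (A : Finset ι) :
    ∃ D : List (ℂ × ℕ), ((D.map Prod.snd).sum ≤ A.card) ∧ (∀ p ∈ D, 1 ≤ p.2) ∧
      ∀ w : ℂ, (∀ p ∈ D, 2 * (p.2 : ℝ) * δ ≤ dist w p.1) →
        ∀ j : ℕ, 1 ≤ j → (A.filter fun i => dist w (z i) < j * δ).card ≤ j - 1 := by
  classical
  induction A using Finset.strongInduction with
  | H A ih =>
    rcases A.eq_empty_or_nonempty with rfl | hA
    · refine ⟨[], by simp, by simp, fun w _ j hj => ?_⟩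
      simp
    -- admissible multiplicities `λ ∈ [1, #A]`: some closed disc of radius `λδ` holds `≥ λ` points
    set Λ : Finset ℕ := (Icc 1 A.card).filter fun l =>
      ∃ c : ℂ, l ≤ (A.filter fun i => dist c (z i) ≤ l * δ).card with hΛ
    obtain ⟨i₀, hi₀⟩ := hA
    have h1mem : 1 ∈ Λ := by
      rw [hΛ, mem_filter, mem_Icc]
      refine ⟨⟨le_rfl, card_pos.2 ⟨i₀, hi₀⟩⟩, z i₀, ?_⟩
      refine card_pos.2 ⟨i₀, ?_⟩
      rw [mem_filter]
      exact ⟨hi₀, by simp [hδ.le]⟩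
    have hΛne : Λ.Nonempty := ⟨1, h1mem⟩
    set l₀ : ℕ := Λ.max' hΛne with hl₀
    have hl₀mem : l₀ ∈ Λ := max'_mem Λ hΛne
    have hl₀spec := hl₀mem
    rw [hΛ, mem_filter, mem_Icc] at hl₀spec
    obtain ⟨⟨hl₀1, hl₀A⟩, c₀, hc₀⟩ := hl₀spec
    -- the group removed at this stage and the rest
    set G : Finset ι := A.filter fun i => dist c₀ (z i) ≤ l₀ * δ with hG
    have hGA : G ⊆ A := filter_subset _ _
    have hGcard : l₀ ≤ G.card := hc₀
    have hGne : G.Nonempty := card_pos.1 (by omega)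
    set A' : Finset ι := A \ G with hA'
    have hA'ss : A' ⊂ A := by
      refine ⟨sdiff_subset, fun hsub => ?_⟩
      obtain ⟨x, hx⟩ := hGne
      have := hsub (hGA hx)
      rw [hA', mem_sdiff] at this
      exact this.2 hx
    obtain ⟨D', hsum', hone', hcount'⟩ := ih A' hA'ss
    refine ⟨(c₀, l₀) :: D', ?_, ?_, ?_⟩
    · -- `λ₀ + ∑' ≤ #G + #A' = #A`
      simp only [List.map_cons, List.sum_cons]
      have : A'.card = A.card - G.card := by rw [hA', card_sdiff_of_subset hGA]
      have hle : G.card ≤ A.card := card_le_card hGA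
      omega
    · intro p hp
      rcases List.mem_cons.1 hp with rfl | hp'
      · exact hl₀1
      · exact hone' p hp'
    · intro w hw j hj
      have hw0 : 2 * (l₀ : ℝ) * δ ≤ dist w c₀ := hw (c₀, l₀) (List.mem_cons_self)
      have hw' : ∀ p ∈ D', 2 * (p.2 : ℝ) * δ ≤ dist w p.1 :=
        fun p hp => hw p (List.mem_cons_of_mem _ hp)
      set N : Finset ι := A.filter fun i => dist w (z i) < j * δ with hN
      by_contra hNot
      push Not at hNot  -- `j - 1 < #N`, i.e. `j ≤ #N`
      have hjN : j ≤ N.card := by omega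
      -- is some point of `N` in the removed group `G`?
      by_cases hx : ∃ x ∈ N, x ∈ G
      · obtain ⟨x, hxN, hxG⟩ := hx
        -- then `j ≤ #A`, `j` is admissible with centre `w`, so `j ≤ λ₀`
        have hjA : j ≤ A.card := hjN.trans (card_le_card (filter_subset _ _))
        have hjΛ : j ∈ Λ := by
          rw [hΛ, mem_filter, mem_Icc]
          refine ⟨⟨hj, hjA⟩, w, hjN.trans (card_le_card fun i hi => ?_)⟩
          rw [hN, mem_filter] at hi
          rw [mem_filter]
          exact ⟨hi.1, hi.2.le⟩
        have hjl₀ : j ≤ l₀ := le_max' Λ j hjΛ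
        rw [hN, mem_filter] at hxN
        rw [hG, mem_filter] at hxG
        have hjl₀' : (j : ℝ) ≤ l₀ := by exact_mod_cast hjl₀
        have hdist : dist w c₀ < 2 * (l₀ : ℝ) * δ :=
          calc dist w c₀ ≤ dist w (z x) + dist (z x) c₀ := dist_triangle _ _ _
            _ < j * δ + l₀ * δ := by
                rw [dist_comm (z x) c₀]
                exact add_lt_add_of_lt_of_le hxN.2 hxG.2
            _ ≤ l₀ * δ + l₀ * δ := by gcongr
            _ = 2 * (l₀ : ℝ) * δ := by ring
        exact absurd hw0 (not_le.2 hdist)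
      · -- no: then `N ⊆ A'`, and the induction hypothesis counts
        push Not at hx
        have hNsub : N ⊆ A'.filter fun i => dist w (z i) < j * δ := by
          intro i hi
          have hi' := hi
          rw [hN, mem_filter] at hi'
          rw [mem_filter, hA', mem_sdiff]
          exact ⟨⟨hi'.1, hx i hi⟩, hi'.2⟩
        have := (card_le_card hNsub).trans (hcount' w hw' j hj)
        omega

/-! ### Cartan's lemma -/

/-- `∑_k 2 λ_k δ = 2 δ ∑_k λ_k` for a list. [folklore] -/
theorem sum_map_two_mul_mul (D : List (ℂ × ℕ)) (δ : ℝ) :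
    (D.map fun p => 2 * (p.2 : ℝ) * δ).sum = 2 * δ * (((D.map Prod.snd).sum : ℕ) : ℝ) := by
  induction D with
  | nil => simp
  | cons p D ih =>
    simp only [List.map_cons, List.sum_cons, Nat.cast_add]
    rw [ih]; ring

/-- **Cartan's lemma** (H. Cartan 1928). For points `z_i` (`i ∈ s`, `n = #s ≥ 1`, repetitions
allowed) and `H > 0` there is a finite list of discs `D(c_k, ρ_k)` with `ρ_k > 0` and
`∑ ρ_k ≤ 2H` such that `∏_{i ∈ s} |w − z_i| ≥ n! (H/n)ⁿ` for every `w` with `dist(w, c_k) ≥ ρ_k`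
for all `k`. (Levin's form has `(H/e)ⁿ < n!(H/n)ⁿ` on the right.)
[cite: Cartan1928, Levin Ch. I §7 Thm 10] -/
theorem exists_discs_prod_ge (s : Finset ι) (hs : s.Nonempty) (z : ι → ℂ) {H : ℝ} (hH : 0 < H) :
    ∃ D : List (ℂ × ℝ), (∀ p ∈ D, 0 < p.2) ∧ (D.map Prod.snd).sum ≤ 2 * H ∧
      ∀ w : ℂ, (∀ p ∈ D, p.2 ≤ dist w p.1) →
        ((s.card.factorial : ℕ) : ℝ) * (H / s.card) ^ s.card ≤ ∏ i ∈ s, ‖w - z i‖ := by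
  classical
  have hn : (0 : ℝ) < s.card := by exact_mod_cast hs.card_pos
  set δ : ℝ := H / s.card with hδ
  have hδ0 : 0 < δ := div_pos hH hn
  obtain ⟨D, hsum, hone, hcount⟩ := exists_discs z hδ0 s
  refine ⟨D.map fun p => (p.1, 2 * (p.2 : ℝ) * δ), ?_, ?_, ?_⟩
  · intro p hp
    rw [List.mem_map] at hp
    obtain ⟨q, hq, rfl⟩ := hp
    have := hone q hq
    positivity
  · rw [List.map_map]
    have : (D.map (Prod.snd ∘ fun p : ℂ × ℕ => (p.1, 2 * (p.2 : ℝ) * δ))) =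
        D.map fun p => 2 * (p.2 : ℝ) * δ := List.map_congr_left fun p _ => rfl
    rw [this, sum_map_two_mul_mul]
    have hsum' : (((D.map Prod.snd).sum : ℕ) : ℝ) ≤ s.card := by exact_mod_cast hsum
    calc 2 * δ * (((D.map Prod.snd).sum : ℕ) : ℝ) ≤ 2 * δ * s.card := by gcongr
      _ = 2 * H := by rw [hδ]; field_simp
  · intro w hw
    have hw' : ∀ p ∈ D, 2 * (p.2 : ℝ) * δ ≤ dist w p.1 := by
      intro p hp
      exact hw (p.1, 2 * (p.2 : ℝ) * δ) (List.mem_map.2 ⟨p, hp, rfl⟩)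
    have hc := hcount w hw'
    have key := factorial_mul_pow_le_prod s (fun i => dist w (z i)) hδ0 hc
    simpa only [dist_eq_norm] using key

/-! ### A good circle -/

/-- Lebesgue measure of a finite union of sets indexed by a list is at most the sum.
[folklore] -/
theorem volume_biUnion_list_le {α : Type*} (l : List α) (S : α → Set ℝ) :
    volume (⋃ p ∈ l, S p) ≤ (l.map fun p => volume (S p)).sum := by
  induction l with
  | nil => simp
  | cons a l ih =>
    simp only [List.mem_cons, List.map_cons, List.sum_cons]
    have : (⋃ p ∈ a :: l, S p) = S a ∪ ⋃ p ∈ l, S p := by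
      ext x; simp
    calc volume (⋃ p, ⋃ (_ : p = a ∨ p ∈ l), S p) = volume (S a ∪ ⋃ p ∈ l, S p) := by
          rw [← this]; simp
      _ ≤ volume (S a) + volume (⋃ p ∈ l, S p) := measure_union_le _ _
      _ ≤ volume (S a) + (l.map fun p => volume (S p)).sum := add_le_add le_rfl ih

/-- **Cartan's lemma on circles.** With `z_i`, `n = #s ≥ 1`, `H > 0` as above: every interval
`[a, a + L]` of radii with `L > 4H` contains an `r` such that
`∏_{i ∈ s} |w − z_i| ≥ n! (H/n)ⁿ` for all `w` on the circle `|w| = r`. (The exceptional discs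
`D(c_k, ρ_k)`, `∑ ρ_k ≤ 2H`, meet the circle `|w| = r` only if `r ∈ (|c_k| − ρ_k, |c_k| + ρ_k)`,
intervals of total length `≤ 4H`.) This is the form in which Turán's power-sum method uses Cartan's
lemma. [cite: Turan1951Carlson, p. 48–49] -/
theorem exists_radius_prod_ge (s : Finset ι) (hs : s.Nonempty) (z : ι → ℂ) {H : ℝ} (hH : 0 < H)
    (a : ℝ) {L : ℝ} (hL : 4 * H < L) :
    ∃ r ∈ Set.Icc a (a + L), ∀ w : ℂ, ‖w‖ = r →
      ((s.card.factorial : ℕ) : ℝ) * (H / s.card) ^ s.card ≤ ∏ i ∈ s, ‖w - z i‖ := by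
  obtain ⟨D, hpos, hsum, hgood⟩ := exists_discs_prod_ge s hs z hH
  -- the bad radii
  set B : Set ℝ := ⋃ p ∈ D, Set.Ioo (‖p.1‖ - p.2) (‖p.1‖ + p.2) with hB
  have hvolB : volume B ≤ ENNReal.ofReal (4 * H) := by
    refine (volume_biUnion_list_le D _).trans ?_
    have : (D.map fun p : ℂ × ℝ => volume (Set.Ioo (‖p.1‖ - p.2) (‖p.1‖ + p.2))) =
        D.map fun p => ENNReal.ofReal (2 * p.2) := by
      refine List.map_congr_left fun p hp => ?_
      rw [Real.volume_Ioo]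
      congr 1; ring
    rw [this]
    -- `∑ ofReal (2 ρ_k) = ofReal (2 ∑ ρ_k) ≤ ofReal (4H)`
    have hsum2 : ∀ (l : List (ℂ × ℝ)), (∀ p ∈ l, 0 < p.2) →
        (l.map fun p => ENNReal.ofReal (2 * p.2)).sum = ENNReal.ofReal (2 * (l.map Prod.snd).sum) := by
      intro l hl
      induction l with
      | nil => simp
      | cons p l ih =>
        have hp : 0 < p.2 := hl p List.mem_cons_self
        have hl' : ∀ q ∈ l, 0 < q.2 := fun q hq => hl q (List.mem_cons_of_mem _ hq)
        have hnn : 0 ≤ (l.map Prod.snd).sum :=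
          List.sum_nonneg (by
            intro x hx
            rw [List.mem_map] at hx
            obtain ⟨q, hq, rfl⟩ := hx
            exact (hl' q hq).le)
        simp only [List.map_cons, List.sum_cons]
        rw [ih hl', ← ENNReal.ofReal_add (by positivity) (by positivity)]
        congr 1; ring
    rw [hsum2 D hpos]
    exact ENNReal.ofReal_le_ofReal (by linarith)
  have hvolI : volume (Set.Icc a (a + L)) = ENNReal.ofReal L := by
    rw [Real.volume_Icc]; congr 1; ring
  -- `Icc \ B` has positive measure, hence is nonempty
  have hdiff : volume (Set.Icc a (a + L) \ B) ≠ 0 := by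
    have h1 : volume (Set.Icc a (a + L)) - volume B ≤ volume (Set.Icc a (a + L) \ B) :=
      le_measure_sdiff
    have h2 : ENNReal.ofReal L - ENNReal.ofReal (4 * H) ≤ volume (Set.Icc a (a + L)) - volume B := by
      rw [hvolI]; exact tsub_le_tsub_left hvolB _
    have h3 : 0 < ENNReal.ofReal L - ENNReal.ofReal (4 * H) := by
      rw [tsub_pos_iff_lt]
      exact (ENNReal.ofReal_lt_ofReal_iff (by linarith)).2 hL
    exact ne_of_gt (h3.trans_le (h2.trans h1))
  obtain ⟨r, hrI, hrB⟩ := nonempty_of_measure_ne_zero hdiff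
  refine ⟨r, hrI, fun w hw => hgood w fun p hp => ?_⟩
  by_contra hlt
  push Not at hlt
  apply hrB
  rw [hB, Set.mem_iUnion₂]
  refine ⟨p, hp, ?_⟩
  rw [Set.mem_Ioo]
  have h1 : |‖w‖ - ‖p.1‖| ≤ dist w p.1 := by
    rw [dist_eq_norm]; exact abs_norm_sub_norm_le w p.1
  rw [hw] at h1
  have h2 := (abs_le.1 (h1.trans hlt.le))
  have h3 : |r - ‖p.1‖| < p.2 := lt_of_le_of_lt h1 hlt
  rw [abs_lt] at h3
  constructor <;> linarith [h3.1, h3.2]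

end Literature.Analysis.Complex.Cartan
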